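import Literature.MathematicalPhysics.QuantumFieldTheory.Balaban1983to89.Node00.BackgroundMapOfRecord
import Literature.MathematicalPhysics.QuantumFieldTheory.Balaban1983to89.Node00.BetaTransportComparison

/-!
# CRIT-1 g35 — JUNK-INHABITANT PROBE for `Node00.BgScheme` + its four (11′)-tokens (`BackgroundMapOfRecord.lean` ✓p811606, 86319d59)

Shape claim for ★★★ №511's planned support statement «P0Content := the conjunction of the displayed (11′) content tokens at the record»:
for ANY domain `D`, ANY carriers `𝒴 𝒵`, the ZERO SCHEME (`𝒢 = 0, W = 0, J = 0, 𝔄 = 0, ev = 0, bg := Uk` (the record's choice selector),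
constants `B₀ = C₄ = j = ε₄ = 0, a₃ = 2, a = 1`) satisfies `RegimeTok` and `ChartSUTok` OUTRIGHT, and on it `Prop7Tok ε ↔ ∀ V ∈ D, UkExists V`,
`UniqTok ε ↔ ∀ V ∈ D, UniqueUkOrbit V`.  Hence the ∃-form «∃ S, S.dom = D ∧ (four tokens)» is EQUIVALENT to the old E+U token
«∀ V ∈ D, UkExists V ∧ UniqueUkOrbit V» — it carries NO contraction ∕ analyticity content; a content item must NAME THE INSTANCE (P0-rec proper)
or display the data-analyticity premises of §5 and pin `ev`∕`bg`∕`dom` to the record's objects.  Kernel bookkeeping only; nothing of Bałaban asserted.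
-/

namespace Crit1P0Junk

open Literature.MathematicalPhysics.QuantumFieldTheory.Balaban1983to89
open Literature.MathematicalPhysics.QuantumFieldTheory.Balaban1983to89.Node00
open Literature.MathematicalPhysics.QuantumFieldTheory.Balaban1983to89.T4Continuum (T4Family)

variable (F : T4Family) (N : ℕ) [NeZero N]
variable (𝒴 𝒵 : Type) [NormedAddCommGroup 𝒴] [NormedSpace ℂ 𝒴] [NormedAddCommGroup 𝒵] [NormedSpace ℂ 𝒵]

/-- The zero scheme over an arbitrary domain `D`, background := the record's choice selector `Uk`. -/
noncomputable def junk (K k : ℕ) (ε : ℝ) (D : Set (GaugeField (F.P K) k (SU N))) : BgScheme F N 𝒴 𝒵 K k where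
  dom := D
  bg := fun V => Uk F N K k ε V
  𝒢 := fun _ => 0
  W := fun _ _ => 0
  J := fun _ => 0
  𝔄 := fun _ => 0
  B₀ := 0
  C₄ := 0
  a₃ := 2
  j := 0
  a := 1
  ε₄ := 0
  ev := 0

variable {F N 𝒴 𝒵} {K k : ℕ} {ε : ℝ} {D : Set (GaugeField (F.P K) k (SU N))}

theorem regimeTok_junk : (junk F N 𝒴 𝒵 K k ε D).RegimeTok := by
  intro V _
  refine ⟨⟨fun f => by simp [junk], fun Y => by simp, ⟨fun Y _ => by simp [junk], fun P Q => ?_⟩, le_rfl, le_rfl, le_rfl, le_rfl,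
    by norm_num [junk], by norm_num [junk], by norm_num [junk]⟩, by simp [junk], by norm_num [junk]⟩
  simp only [junk]
  exact differentiableOn_const _

theorem expo_junk (V : GaugeField (F.P K) k (SU N)) (b : PBond (F.P K) 0) : (junk F N 𝒴 𝒵 K k ε D).expo V b = 1 := by
  simp only [BgScheme.expo, junk, LinearMap.zero_apply, Pi.zero_apply, smul_zero, NormedSpace.exp_zero]

theorem chartSUTok_junk : (junk F N 𝒴 𝒵 K k ε D).ChartSUTok := by
  intro V _ b
  rw [expo_junk]
  exact Submonoid.one_mem _

theorem chartCfg_junk (V : GaugeField (F.P K) k (SU N)) : (junk F N 𝒴 𝒵 K k ε D).chartCfg V = Uk F N K k ε V := by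
  funext b
  rw [BgScheme.chartCfg_apply, expo_junk, suOfMat_one, one_mul]
  rfl

theorem gaugeAct_one_eq (U : GaugeField (F.P K) 0 (SU N)) : GaugeField.gaugeAct (fun _ => (1 : SU N)) U = U := by
  funext b; simp [GaugeField.gaugeAct]

theorem prop7Tok_junk_iff : (junk F N 𝒴 𝒵 K k ε D).Prop7Tok ε ↔ ∀ V ∈ D, UkExists F N K k ε V := by
  constructor
  · intro h V hV
    exact BgScheme.ukExists_of_prop7Tok h hV
  · intro h V hV
    refine ⟨fun _ => 1, ?_⟩
    rw [gaugeAct_one_eq, chartCfg_junk]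
    exact isBackground_Uk (h V hV)

theorem uniqTok_junk_iff : (junk F N 𝒴 𝒵 K k ε D).UniqTok ε ↔ ∀ V ∈ D, UniqueUkOrbit F N K k ε V := Iff.rfl

/-- ★ THE COLLAPSE: an ∃-form «P0Content» over `BgScheme` with the four tokens is EXACTLY the E+U token (TokE ∕ `h11`). -/
theorem exists_scheme_tokens_iff :
    (∃ S : BgScheme F N 𝒴 𝒵 K k, S.dom = D ∧ S.RegimeTok ∧ S.ChartSUTok ∧ S.Prop7Tok ε ∧ S.UniqTok ε) ↔
      ∀ V ∈ D, UkExists F N K k ε V ∧ UniqueUkOrbit F N K k ε V := by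
  constructor
  · rintro ⟨S, rfl, -, -, h7, hU⟩ V hV
    exact ⟨BgScheme.ukExists_of_prop7Tok h7 hV, hU V hV⟩
  · intro h
    exact ⟨junk F N 𝒴 𝒵 K k ε D, rfl, regimeTok_junk, chartSUTok_junk, prop7Tok_junk_iff.2 fun V hV => (h V hV).1,
      fun V hV => (h V hV).2⟩

/-- In particular on the EMPTY domain every token holds — the ∃-form is TRIVIALLY TRUE there (vacuity if `dom` is left free). -/
theorem tokens_junk_empty :
    (junk F N 𝒴 𝒵 K k ε ∅).RegimeTok ∧ (junk F N 𝒴 𝒵 K k ε ∅).ChartSUTok ∧ (junk F N 𝒴 𝒵 K k ε ∅).Prop7Tok ε ∧ (junk F N 𝒴 𝒵 K k ε ∅).UniqTok ε :=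
  ⟨regimeTok_junk, chartSUTok_junk, prop7Tok_junk_iff.2 fun _ h => h.elim, fun _ h => h.elim⟩

end Crit1P0Junk
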